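import Literature.Analysis.FluidPDE.OnsagerBDSVThreeStages
import Literature.Analysis.FunctionSpaces.TorusInverseLaplacian
import HarnessLib

/-!
# The BDSV gluing stage: its three printed ingredients (named facts)

Buckmaster–De Lellis–Székelyhidi–Vicol (BDSV), *Onsager's conjecture for admissible weak
solutions*, CPAM 72 (2019) = arXiv:1701.08678, carry out the *gluing stage* of their scheme
(§2.5, the named fact `BDSV.gluingStage` of `OnsagerBDSVThreeStages.lean`: from the mollified
Euler–Reynolds triple `(v_ℓ, p_ℓ, R̊_ℓ)` with (2.13)–(2.14) to a triple `(v̄_q, p̄_q, R̊̄_q)` whose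
stress is supported on the pairwise disjoint intervals `Iᵢ` (2.17) and which satisfies
(2.18)–(2.22)) in two sections:

* **§3, exact solutions and their stability.** With `tᵢ = i τ_q`, `vᵢ` is the smooth solution of
  the Euler equations with `vᵢ(tᵢ) = v_ℓ(tᵢ)` (3.1), which exists for `|t - tᵢ| ≤ τ_q` by the
  classical local existence theorem in Hölder spaces (Prop. 3.1, quoted from Majda–Bertozzi) and
  the CFL-type condition `τ_q ‖v_ℓ‖_{1+α} ≲ ℓ^α ≪ 1` (§2.5); Cor. 3.2 bounds `‖vᵢ‖_{N+α}`,
  Prop. 3.3 bounds `vᵢ - v_ℓ`, `∇(p_ℓ - pᵢ)` and `D_{t,ℓ}(vᵢ - v_ℓ)` (`D_{t,ℓ} = ∂ₜ + v_ℓ·∇`,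
  (3.9)), and Prop. 3.4 bounds the differences `zᵢ - zᵢ₊₁` of the vector potentials
  `zᵢ = ℬvᵢ = (-Δ)⁻¹ curl vᵢ` and their transport derivatives.
* **§4, gluing.** A partition of unity `χᵢ` in time (§4.1) glues `v̄_q = ∑ χᵢ vᵢ`,
  `p̄_q = ∑ χᵢ pᵢ - χᵢ(1-χᵢ)|vᵢ - vᵢ₊₁|²`, and the new stress
  `R̊̄_q = ∂ₜχᵢ ℛ(vᵢ - vᵢ₊₁) - χᵢ(1-χᵢ)(vᵢ - vᵢ₊₁) ⊗̊ (vᵢ - vᵢ₊₁)` on `Iᵢ` (§4.2, `ℛ` the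
  De Lellis–Székelyhidi antidivergence, Prop. 4.1 — in the tree as `Torus.antidivergence` with
  `Torus.tensorDivergence_antidivergence`); Props. 4.2, 4.3, 4.4 are the estimates (2.18)–(2.22).

This file transcribes the three ingredients as **named facts** (`def … : Prop`, D-0014), in the
exact form in which the assembly `OnsagerBDSVGluingProofs.lean` combines them into
`BDSV.gluingStage`:

* `BDSV.localEulerHolder` = Prop. 3.1 (local existence, uniqueness and the bounds
  `‖u‖_{N+α} ≲ ‖u₀‖_{N+α}`, `N ≥ 1`, for `T ‖u₀‖_{1+α} ≤ c(α)`);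
* `BDSV.gluingStability` = §3 (Cor. 3.2, Prop. 3.3, Prop. 3.4): under (2.13)–(2.14) and for `a`
  large, every smooth exact Euler solution on `Sᵢ = [tᵢ - τ_q, tᵢ + τ_q] ∩ [0,T]` with
  `v(tᵢ) = v_ℓ(tᵢ)` obeys the bounds of Cor. 3.2 and Prop. 3.3 on `Sᵢ`
  (`BDSV.StabilityBounds`), and every pair of such solutions anchored at `tᵢ`, `tᵢ₊₁` obeys the
  bounds of Prop. 3.4 on `Sᵢ ∩ Sᵢ₊₁` (`BDSV.PotentialBounds`);
* `BDSV.gluedTripleEstimates` = §4 (§§4.1–4.2 with Prop. 4.1, Props. 4.2–4.4): from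
  `(v_ℓ, p_ℓ, R̊_ℓ)` with (2.13)–(2.14) and any family `(vᵢ, pᵢ)` of exact solutions anchored at
  the `tᵢ ≤ T` with the §3 bounds, an Euler–Reynolds triple with (2.17)–(2.22).

## Vocabulary

* `BDSV.HolderSupOnLE S f N r B`: `‖f(t)‖_{N+r} ≤ B` for `t ∈ S` (`BDSV.HolderSupLE T` is the case
  `S = [0,T]`, `BDSV.holderSupLE_iff`), with the accepted `Torus.eContDiffHolderNorm N r`.
* `BDSV.advectiveDerivWithin S u G = ∂ₜG + (u·∇)G` with the one-sided time derivative within the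
  time set `S` (`BDSV.advectiveDeriv T` is the case `S = [0,T]`).
* `BDSV.curl`, `BDSV.biotSavart v = (-Δ)⁻¹ curl v = -Δ⁻¹(curl v)` on `T³` (the accepted
  `Torus.invLaplacian`), the vector potential of §3.3.
* `BDSV.IsExactEulerOn S v p`: smooth solutions of the Euler equations on `S × T³`, i.e.
  Euler–Reynolds triples (`Torus.IsEulerReynoldsOn`) with zero stress.
* `BDSV.glueInterval T τ i = [iτ - τ, iτ + τ] ∩ [0,T]`: the life span `|t - tᵢ| ≤ τ_q` of `vᵢ`
  within `[0,T]` (Cor. 3.2, Props. 3.3–3.4: "for `|t - tᵢ| ≤ τ_q`").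

## Design choices

* "`vᵢ`" is rendered as *any* smooth exact solution on `Sᵢ` with the datum `v_ℓ(tᵢ)` at `tᵢ`: by
  the uniqueness part of Prop. 3.1 this is the solution of (3.1), and the form avoids choice
  functions in statements. Existence (Prop. 3.1 with the CFL condition) is invoked in the
  assembly, as in §3.1.
* The family glued in §4 is indexed by the anchors `tᵢ = iτ_q ≤ T` only. The printed construction
  also uses, on the last interval `Iₙ ∩ [0,T]`, the solution `vₙ₊₁` with datum at
  `tₙ₊₁ > T`, where `v_ℓ` is not defined; the standard repair (merge the last two cut-offs,
  `χ̃ₙ = ∑_{j ≥ n} χⱼ ≡ 1` on `[tₙ - τ_q/3, T]`, so that `v̄_q = vₙ` and `R̊̄_q = 0` there) uses only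
  anchors in `[0,T]` and yields (2.17)–(2.22) verbatim. `BDSV.gluedTripleEstimates` is stated
  for this input and as an existence statement (the explicit formulas belong to its proof).
* Numbers of derivatives: the §4 fact consumes the §3 bounds up to order `N̄ + 2` and returns
  (2.18)–(2.22) up to order `N̄`; the §3 fact delivers any requested order. Constants: one real
  constant per fact, quantified after `(β, b, α, N̄, C_N)` and before the threshold `a₀`, as in
  `OnsagerBDSVThreeStages.lean`; equation numbers (2.13)–(2.22), (3.9) are those used there.
* Prop. 3.1 is transcribed with norm bounds as hypotheses (`‖u₀‖_{1+α} ≤ K`, `T K ≤ c`) rather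
  than real-valued norms (the accepted norms are `ℝ≥0∞`-valued); "`T ≤ c‖u₀‖_{1+α}`" in the
  printed statement is the obvious misprint for `T ≤ c‖u₀‖_{1+α}⁻¹` (cf. its use through the
  CFL condition of §2.5 in Cor. 3.2).

## References

* T. Buckmaster, C. De Lellis, L. Székelyhidi Jr., V. Vicol, *Onsager's conjecture for admissible
  weak solutions*, Comm. Pure Appl. Math. 72 (2019) 229–274 = arXiv:1701.08678: §2.5
  (2.16)–(2.22); §3.1 (3.1), Prop. 3.1, Cor. 3.2; §3.2 Prop. 3.3, (3.9); §3.3 Prop. 3.4; §4.1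
  (cut-offs), §4.2 (Prop. 4.1, the glued triple), §4.3 Prop. 4.2, §4.4 Props. 4.3–4.4.
* A. J. Majda, A. L. Bertozzi, *Vorticity and incompressible flow*, CUP 2002 (the reference
  `[MaBe2002]` of Prop. 3.1).
* C. De Lellis, L. Székelyhidi Jr., *Dissipative continuous Euler flows*, Invent. Math. 193
  (2013), §4 (the operator `ℛ`).
-/

open MeasureTheory Set
open scoped NNReal ENNReal ContDiff

noncomputable section

namespace Literature.Analysis.FluidPDE

namespace BDSV

/-- The flat three-torus `T³ = (ℝ/ℤ)³`, local notation. -/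
local notation "𝕋³" => UnitAddTorus (Fin 3)

/-- Euclidean `ℝ³`, local notation. -/
local notation "ℝ³" => EuclideanSpace ℝ (Fin 3)

/-! ## Vocabulary -/

section Vocabulary

variable {F : Type*} [NormedAddCommGroup F] [NormedSpace ℝ F]

/-- `‖f‖_{N+r} ≤ B` on a time set `S` (BDSV App. A, spatial Hölder norms of the time slices):
for every `t ∈ S` the `C^{N,r}(T³)` norm `Torus.eContDiffHolderNorm N r` of `f(t)` is at most
`B`. For `S = [0,T]` this is `BDSV.HolderSupLE T`. [cite: BuckmasterEtAl2018, App. A (Hölder spaces)] -/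
def HolderSupOnLE (S : Set ℝ) (f : ℝ → 𝕋³ → F) (N : ℕ) (r : ℝ≥0) (B : ℝ) : Prop :=
  ∀ t ∈ S, FunctionSpaces.Torus.eContDiffHolderNorm N r (f t) ≤ ENNReal.ofReal B

/-- `BDSV.HolderSupLE T` is `BDSV.HolderSupOnLE [0,T]`. [folklore] -/
theorem holderSupLE_iff {T : ℝ} {f : ℝ → 𝕋³ → F} {N : ℕ} {r : ℝ≥0} {B : ℝ} :
    HolderSupLE T f N r B ↔ HolderSupOnLE (Icc 0 T) f N r B :=
  Iff.rfl

variable {S S' : Set ℝ} {f : ℝ → 𝕋³ → F} {N : ℕ} {r : ℝ≥0} {B B' : ℝ}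

/-- Monotonicity of `‖f‖_{N+r} ≤ B` on `S` in the bound. [folklore] -/
theorem HolderSupOnLE.mono (h : HolderSupOnLE S f N r B) (hB : B ≤ B') : HolderSupOnLE S f N r B' :=
  fun t ht => (h t ht).trans (ENNReal.ofReal_le_ofReal hB)

/-- Monotonicity of `‖f‖_{N+r} ≤ B` on `S` in the time set. [folklore] -/
theorem HolderSupOnLE.anti (h : HolderSupOnLE S f N r B) (hS : S' ⊆ S) : HolderSupOnLE S' f N r B :=
  fun t ht => h t (hS ht)

/-- The transport (advective) derivative `∂ₜG + (u·∇)G` of a field `G` along `u` on `S × T³`,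
with the one-sided time derivative within the time set `S` (BDSV (3.9): `D_{t,ℓ} = ∂ₜ + v_ℓ·∇`,
applied in §3 to fields living on the life spans `|t - tᵢ| ≤ τ_q` of the exact solutions).
`BDSV.advectiveDeriv T` is the case `S = [0,T]`. [cite: BuckmasterEtAl2018, §3.2 (3.9)] -/
def advectiveDerivWithin (S : Set ℝ) (u : ℝ → 𝕋³ → ℝ³) (G : ℝ → 𝕋³ → F) : ℝ → 𝕋³ → F :=
  fun t x => FunctionSpaces.Torus.timeDerivWithin S G t x + FunctionSpaces.Torus.convect (u t) (G t) x

/-- `BDSV.advectiveDeriv T = BDSV.advectiveDerivWithin [0,T]`. [folklore] -/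
theorem advectiveDeriv_eq_advectiveDerivWithin (T : ℝ) (u : ℝ → 𝕋³ → ℝ³) (G : ℝ → 𝕋³ → F) :
    advectiveDeriv T u G = advectiveDerivWithin (Icc 0 T) u G :=
  rfl

/-- The curl of a vector field on `T³`, `(curl v)₀ = ∂₁v₂ - ∂₂v₁`, `(curl v)₁ = ∂₂v₀ - ∂₀v₂`,
`(curl v)₂ = ∂₀v₁ - ∂₁v₀` (indices `0,1,2`), with the accepted `Torus.partialDeriv`. [folklore] -/
def curl (v : 𝕋³ → ℝ³) (x : 𝕋³) : ℝ³ :=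
  let D : Fin 3 → Fin 3 → ℝ := fun j i => FunctionSpaces.Torus.partialDeriv j v x i
  WithLp.toLp 2 ![D 1 2 - D 2 1, D 2 0 - D 0 2, D 0 1 - D 1 0]

/-- The Biot–Savart vector potential on `T³`, `ℬ v := (-Δ)⁻¹ curl v = -Δ⁻¹(curl v)` with the
accepted mean-zero inverse Laplacian `Torus.invLaplacian` (BDSV §3.3: `zᵢ = ℬvᵢ`, "where `ℬ` is
the Biot–Savart operator, so that `div zᵢ = 0` and `curl zᵢ = vᵢ`" — the latter for mean-free
`vᵢ`). [cite: BuckmasterEtAl2018, §3.3 (vector potentials)] -/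
def biotSavart (v : 𝕋³ → ℝ³) (x : 𝕋³) : ℝ³ :=
  -FunctionSpaces.Torus.invLaplacian (curl v) x

/-- Smooth (classical) solutions of the incompressible Euler equations on `S × T³`: Euler–Reynolds
triples (`Torus.IsEulerReynoldsOn`: jointly smooth, `∂ₜv + (v·∇)v + ∇p = div R̊`, `div v = 0`,
mean-zero pressure) with zero stress (BDSV (3.1): the exact solutions `vᵢ` glued in §4).
[cite: BuckmasterEtAl2018, §3.1 (3.1)] -/
def IsExactEulerOn (S : Set ℝ) (v : ℝ → 𝕋³ → ℝ³) (p : ℝ → 𝕋³ → ℝ) : Prop :=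
  Torus.IsEulerReynoldsOn S v p (fun _ _ _ => 0)

/-- The zero pair is an exact Euler solution on every time set. [folklore] -/
theorem isExactEulerOn_zero (S : Set ℝ) : IsExactEulerOn S (fun _ _ => 0) (fun _ _ => 0) :=
  Torus.isEulerReynoldsOn_zero S

/-- The life span of the `i`-th exact solution inside `[0,T]`: `Sᵢ = [iτ - τ, iτ + τ] ∩ [0,T]`,
i.e. the times `t ∈ [0,T]` with `|t - tᵢ| ≤ τ`, `tᵢ = iτ` (BDSV Cor. 3.2, Props. 3.3, 3.4: "for
`|t - tᵢ| ≤ τ_q`"). [cite: BuckmasterEtAl2018, §3.1 (Cor. 3.2)] -/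
def glueInterval (T τ : ℝ) (i : ℕ) : Set ℝ :=
  Icc ((i : ℝ) * τ - τ) ((i : ℝ) * τ + τ) ∩ Icc 0 T

/-- `Sᵢ ⊆ [0,T]`. [folklore] -/
theorem glueInterval_subset_Icc (T τ : ℝ) (i : ℕ) : glueInterval T τ i ⊆ Icc 0 T :=
  inter_subset_right

/-- The anchor `tᵢ = iτ` lies in `Sᵢ` as soon as `0 ≤ τ` and `iτ ≤ T`. [folklore] -/
theorem anchor_mem_glueInterval {T τ : ℝ} (hτ : 0 ≤ τ) {i : ℕ} (hi : (i : ℝ) * τ ≤ T) :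
    (i : ℝ) * τ ∈ glueInterval T τ i :=
  ⟨⟨by linarith, by linarith⟩, ⟨by positivity, hi⟩⟩

end Vocabulary

/-! ## The bounds of §3 as predicates -/

section StabilityVocabulary

/-- The bounds of Cor. 3.2 and Prop. 3.3 for an exact solution `(v, p)` ("`(vᵢ, pᵢ)`") relative to
the mollified triple `(v_ℓ, p_ℓ)` on the life span `Sᵢ = [tᵢ - τ_q, tᵢ + τ_q] ∩ [0,T]`, with
constant `C` and for the orders `N ≤ N̄` (`ℓ = BDSV.mollScale`, `τ_q = BDSV.glueScale`,
`δ_{q+1} = BDSV.amp β a b (q+1)`, Hölder exponent `α`):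
Cor. 3.2 `‖vᵢ‖_{N+α} ≤ C τ_q⁻¹ ℓ^{1-N+α}` (`1 ≤ N`); Prop. 3.3
`‖vᵢ - v_ℓ‖_{N+α} ≤ C τ_q δ_{q+1} ℓ^{-N-1+α}`, `‖∇(p_ℓ - pᵢ)‖_{N+α} ≤ C δ_{q+1} ℓ^{-N-1+α}`,
`‖D_{t,ℓ}(vᵢ - v_ℓ)‖_{N+α} ≤ C δ_{q+1} ℓ^{-N-1+α}` with `D_{t,ℓ} = ∂ₜ + v_ℓ·∇` (3.9) taken within
`Sᵢ`. [cite: BuckmasterEtAl2018, Cor. 3.2 and Prop. 3.3] -/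
structure StabilityBounds (β α a b T C : ℝ) (q Nbar i : ℕ) (vℓ : ℝ → 𝕋³ → ℝ³) (pℓ : ℝ → 𝕋³ → ℝ)
    (v : ℝ → 𝕋³ → ℝ³) (p : ℝ → 𝕋³ → ℝ) : Prop where
  /-- Cor. 3.2: `‖vᵢ‖_{N+α} ≤ C τ_q⁻¹ ℓ^{1-N+α}` for `1 ≤ N ≤ N̄` on `Sᵢ`. -/
  velocity : ∀ N : ℕ, 1 ≤ N → N ≤ Nbar →
    HolderSupOnLE (glueInterval T (glueScale β α a b q) i) v N (Real.toNNReal α)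
      (C * ((glueScale β α a b q)⁻¹ * mollScale β α a b q ^ (1 - (N : ℝ) + α)))
  /-- Prop. 3.3, first estimate: `‖vᵢ - v_ℓ‖_{N+α} ≤ C τ_q δ_{q+1} ℓ^{-N-1+α}` on `Sᵢ`. -/
  velocity_sub : ∀ N : ℕ, N ≤ Nbar →
    HolderSupOnLE (glueInterval T (glueScale β α a b q) i) (fun t x => v t x - vℓ t x) N
      (Real.toNNReal α)
      (C * (glueScale β α a b q * amp β a b (q + 1) * mollScale β α a b q ^ (-(N : ℝ) - 1 + α)))
  /-- Prop. 3.3, second estimate: `‖∇(p_ℓ - pᵢ)‖_{N+α} ≤ C δ_{q+1} ℓ^{-N-1+α}` on `Sᵢ`. -/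
  pressure : ∀ N : ℕ, N ≤ Nbar →
    HolderSupOnLE (glueInterval T (glueScale β α a b q) i)
      (fun t x => FunctionSpaces.Torus.gradient (fun y => pℓ t y - p t y) x) N (Real.toNNReal α)
      (C * (amp β a b (q + 1) * mollScale β α a b q ^ (-(N : ℝ) - 1 + α)))
  /-- Prop. 3.3, third estimate: `‖D_{t,ℓ}(vᵢ - v_ℓ)‖_{N+α} ≤ C δ_{q+1} ℓ^{-N-1+α}` on `Sᵢ`. -/
  transport : ∀ N : ℕ, N ≤ Nbar →
    HolderSupOnLE (glueInterval T (glueScale β α a b q) i)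
      (advectiveDerivWithin (glueInterval T (glueScale β α a b q) i) vℓ (fun t x => v t x - vℓ t x))
      N (Real.toNNReal α)
      (C * (amp β a b (q + 1) * mollScale β α a b q ^ (-(N : ℝ) - 1 + α)))

/-- The bounds of Prop. 3.4 for the difference of the vector potentials `zᵢ - zᵢ₊₁ = ℬ(vᵢ - vᵢ₊₁)`
of two exact solutions `v` ("`vᵢ`") and `v'` ("`vᵢ₊₁`") on the common life span `Sᵢ ∩ Sᵢ₊₁`
(where `|t - tᵢ| ≤ τ_q` and both exist), with constant `C`, orders `N ≤ N̄`:
`‖zᵢ - zᵢ₊₁‖_{N+α} ≤ C τ_q δ_{q+1} ℓ^{-N+α}` and `‖D_{t,ℓ}(zᵢ - zᵢ₊₁)‖_{N+α} ≤ C δ_{q+1} ℓ^{-N+α}`,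
`D_{t,ℓ} = ∂ₜ + v_ℓ·∇` within `Sᵢ ∩ Sᵢ₊₁`. [cite: BuckmasterEtAl2018, Prop. 3.4] -/
structure PotentialBounds (β α a b T C : ℝ) (q Nbar i : ℕ) (vℓ : ℝ → 𝕋³ → ℝ³)
    (v v' : ℝ → 𝕋³ → ℝ³) : Prop where
  /-- Prop. 3.4, first estimate: `‖ℬ(vᵢ - vᵢ₊₁)‖_{N+α} ≤ C τ_q δ_{q+1} ℓ^{-N+α}` on `Sᵢ ∩ Sᵢ₊₁`. -/
  potential : ∀ N : ℕ, N ≤ Nbar →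
    HolderSupOnLE (glueInterval T (glueScale β α a b q) i ∩ glueInterval T (glueScale β α a b q) (i + 1))
      (fun t x => biotSavart (fun y => v t y - v' t y) x) N (Real.toNNReal α)
      (C * (glueScale β α a b q * amp β a b (q + 1) * mollScale β α a b q ^ (-(N : ℝ) + α)))
  /-- Prop. 3.4, second estimate: `‖D_{t,ℓ} ℬ(vᵢ - vᵢ₊₁)‖_{N+α} ≤ C δ_{q+1} ℓ^{-N+α}` on `Sᵢ ∩ Sᵢ₊₁`. -/
  transport : ∀ N : ℕ, N ≤ Nbar →
    HolderSupOnLE (glueInterval T (glueScale β α a b q) i ∩ glueInterval T (glueScale β α a b q) (i + 1))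
      (advectiveDerivWithin
        (glueInterval T (glueScale β α a b q) i ∩ glueInterval T (glueScale β α a b q) (i + 1)) vℓ
        (fun t x => biotSavart (fun y => v t y - v' t y) x)) N (Real.toNNReal α)
      (C * (amp β a b (q + 1) * mollScale β α a b q ^ (-(N : ℝ) + α)))

variable {β α a b T C C' : ℝ} {q Nbar Nbar' i : ℕ} {vℓ : ℝ → 𝕋³ → ℝ³} {pℓ : ℝ → 𝕋³ → ℝ}
  {v v' : ℝ → 𝕋³ → ℝ³} {p : ℝ → 𝕋³ → ℝ}

/-- The §3 bounds for `N ≤ N̄` imply those for `N ≤ N̄'` when `N̄' ≤ N̄`. [folklore] -/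
theorem StabilityBounds.of_le (h : StabilityBounds β α a b T C q Nbar i vℓ pℓ v p) (hN : Nbar' ≤ Nbar) :
    StabilityBounds β α a b T C q Nbar' i vℓ pℓ v p where
  velocity N h1 hN' := h.velocity N h1 (hN'.trans hN)
  velocity_sub N hN' := h.velocity_sub N (hN'.trans hN)
  pressure N hN' := h.pressure N (hN'.trans hN)
  transport N hN' := h.transport N (hN'.trans hN)

/-- The Prop. 3.4 bounds for `N ≤ N̄` imply those for `N ≤ N̄'` when `N̄' ≤ N̄`. [folklore] -/
theorem PotentialBounds.of_le (h : PotentialBounds β α a b T C q Nbar i vℓ v v') (hN : Nbar' ≤ Nbar) :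
    PotentialBounds β α a b T C q Nbar' i vℓ v v' where
  potential N hN' := h.potential N (hN'.trans hN)
  transport N hN' := h.transport N (hN'.trans hN)

end StabilityVocabulary

/-! ## The three named facts -/

section Facts

/-- **Local existence for the Euler equations in Hölder spaces** (BDSV Prop. 3.1, quoted from
Majda–Bertozzi [MaBe2002]: "For any `α > 0` there exists a constant `c = c(α) > 0` with the
following property. Given any initial data `u₀ ∈ C^∞`, and `T ≤ c‖u₀‖_{1+α}⁻¹`, there exists a
unique solution `u : ℝ³ × [-T,T] → ℝ³` to the Euler equation `∂ₜu + div (u ⊗ u) + ∇p = 0`,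
`div u = 0`, `u(·,0) = u₀`. Moreover, `u` obeys the bounds `‖u‖_{N+α} ≲ ‖u₀‖_{N+α}` for all
`N ≥ 1`, where the implicit constant depends on `N` and `α > 0`"; periodic setting `x ∈ T³` as
throughout the paper, `0 < α < 1`). Transcription: for `0 < α < 1` there are `c > 0` and
constants `C_N` such that for every smooth divergence-free `u₀` on `T³`, every `K ≥ 0` with
`‖u₀‖_{1+α} ≤ K` and every `T > 0` with `T K ≤ c`, there is a smooth exact Euler solution
`(u, p)` on `[-T,T] × T³` (`BDSV.IsExactEulerOn`, mean-zero pressure) with `u(0) = u₀`, unique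
among smooth exact solutions on `[-T,T]` with this datum (as to the velocity), and with
`‖u(t)‖_{N+α} ≤ C_N K_N` for `|t| ≤ T` whenever `N ≥ 1` and `‖u₀‖_{N+α} ≤ K_N`; norms are the
accepted `Torus.eContDiffHolderNorm N α` (App. A). [cite: BuckmasterEtAl2018, Prop. 3.1] -/
def localEulerHolder : Prop :=
  ∀ α : ℝ, 0 < α → α < 1 → ∃ c : ℝ, 0 < c ∧ ∃ Cloc : ℕ → ℝ,
    ∀ u₀ : 𝕋³ → ℝ³, FunctionSpaces.Torus.IsSmooth u₀ → FunctionSpaces.Torus.IsDivFree u₀ →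
      ∀ K : ℝ, 0 ≤ K →
        FunctionSpaces.Torus.eContDiffHolderNorm 1 (Real.toNNReal α) u₀ ≤ ENNReal.ofReal K →
        ∀ T : ℝ, 0 < T → T * K ≤ c →
          ∃ (u : ℝ → 𝕋³ → ℝ³) (p : ℝ → 𝕋³ → ℝ),
            IsExactEulerOn (Icc (-T) T) u p ∧ u 0 = u₀ ∧
            (∀ (u' : ℝ → 𝕋³ → ℝ³) (p' : ℝ → 𝕋³ → ℝ), IsExactEulerOn (Icc (-T) T) u' p' →
              u' 0 = u₀ → ∀ t ∈ Icc (-T) T, u' t = u t) ∧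
            ∀ N : ℕ, 1 ≤ N → ∀ K' : ℝ, 0 ≤ K' →
              FunctionSpaces.Torus.eContDiffHolderNorm N (Real.toNNReal α) u₀ ≤ ENNReal.ofReal K' →
                ∀ t ∈ Icc (-T) T,
                  FunctionSpaces.Torus.eContDiffHolderNorm N (Real.toNNReal α) (u t) ≤
                    ENNReal.ofReal (Cloc N * K')

/-- **BDSV gluing stage, §3: stability of the exact solutions** (Cor. 3.2, Prop. 3.3, Prop. 3.4,
for the solutions `vᵢ` of (3.1), `vᵢ(tᵢ) = v_ℓ(tᵢ)`, `tᵢ = iτ_q`, under the standing assumptions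
of §2.3 ("`α` sufficiently small and `a` sufficiently large", in particular the CFL condition of
§2.5) and the mollification estimates (2.13)–(2.14), "where the constant in `≲` might also
depend on `N`"). For `0 < β < 1/3`, `1 < b < (1-β)/(2β)` there is `α₀(β,b) > 0` such that for
`0 < α < α₀`, every `N̄` and every family of constants `(C_N)` there are `C` and `a₀ > 1` such
that for `a ≥ a₀`, `T > 0`, `q` and every Euler–Reynolds triple `(v_ℓ, p_ℓ, R̊_ℓ)` on
`[0,T] × T³` with (2.13) `‖v_ℓ‖_{N+1} ≤ C_N δ_q^{1/2} λ_q ℓ^{-N}` and (2.14)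
`‖R̊_ℓ‖_{N+α} ≤ C_N δ_{q+1} ℓ^{-N+α}` for all `N`: (i) for every `i` with `tᵢ = iτ_q ≤ T`, every
smooth exact Euler solution `(v, p)` on `Sᵢ = [tᵢ - τ_q, tᵢ + τ_q] ∩ [0,T]` with
`v(tᵢ) = v_ℓ(tᵢ)` (by Prop. 3.1 this is `(vᵢ, pᵢ)`) satisfies the bounds of Cor. 3.2 and
Prop. 3.3 for `N ≤ N̄` (`BDSV.StabilityBounds`); (ii) for every `i` with `tᵢ₊₁ ≤ T` and every two
such solutions anchored at `tᵢ` and `tᵢ₊₁`, the vector potentials satisfy the bounds of Prop. 3.4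
on `Sᵢ ∩ Sᵢ₊₁` for `N ≤ N̄` (`BDSV.PotentialBounds`).
[cite: BuckmasterEtAl2018, §3 (Cor. 3.2, Prop. 3.3, Prop. 3.4)] -/
def gluingStability : Prop :=
  ∀ β : ℝ, 0 < β → β < 1 / 3 → ∀ b : ℝ, 1 < b → b < (1 - β) / (2 * β) →
    ∃ α₀ : ℝ, 0 < α₀ ∧ ∀ α : ℝ, 0 < α → α < α₀ → ∀ (Nbar : ℕ) (Cin : ℕ → ℝ),
      ∃ (C a₀ : ℝ), 1 < a₀ ∧ ∀ a : ℝ, a₀ ≤ a → ∀ T : ℝ, 0 < T →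
        ∀ (q : ℕ) (vℓ : ℝ → 𝕋³ → ℝ³) (pℓ : ℝ → 𝕋³ → ℝ) (Rℓ : ℝ → 𝕋³ → Fin 3 → ℝ³),
          Torus.IsEulerReynoldsOn (Icc 0 T) vℓ pℓ Rℓ →
          (∀ N : ℕ, HolderSupLE T vℓ (N + 1) 0
            (Cin N * (Real.sqrt (amp β a b q) * freq a b q * mollScale β α a b q ^ (-(N : ℝ))))) →
          (∀ N : ℕ, HolderSupLE T Rℓ N (Real.toNNReal α)
            (Cin N * (amp β a b (q + 1) * mollScale β α a b q ^ (-(N : ℝ) + α)))) →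
          (∀ (i : ℕ) (v : ℝ → 𝕋³ → ℝ³) (p : ℝ → 𝕋³ → ℝ),
              (i : ℝ) * glueScale β α a b q ≤ T →
              IsExactEulerOn (glueInterval T (glueScale β α a b q) i) v p →
              v ((i : ℝ) * glueScale β α a b q) = vℓ ((i : ℝ) * glueScale β α a b q) →
                StabilityBounds β α a b T C q Nbar i vℓ pℓ v p) ∧
          (∀ (i : ℕ) (v : ℝ → 𝕋³ → ℝ³) (p : ℝ → 𝕋³ → ℝ) (v' : ℝ → 𝕋³ → ℝ³) (p' : ℝ → 𝕋³ → ℝ),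
              ((i + 1 : ℕ) : ℝ) * glueScale β α a b q ≤ T →
              IsExactEulerOn (glueInterval T (glueScale β α a b q) i) v p →
              v ((i : ℝ) * glueScale β α a b q) = vℓ ((i : ℝ) * glueScale β α a b q) →
              IsExactEulerOn (glueInterval T (glueScale β α a b q) (i + 1)) v' p' →
              v' (((i + 1 : ℕ) : ℝ) * glueScale β α a b q) =
                vℓ (((i + 1 : ℕ) : ℝ) * glueScale β α a b q) →
                PotentialBounds β α a b T C q Nbar i vℓ v v')

/-- **BDSV gluing stage, §4: the glued triple and its estimates** (§4.1: partition of unity `χᵢ`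
in time with `supp χᵢ ⊂ (tᵢ - 2τ_q/3, tᵢ + 2τ_q/3)`, `χᵢ = 1` on `Jᵢ`, `‖∂ₜ^N χᵢ‖₀ ≲ τ_q^{-N}`,
`v̄_q = ∑ χᵢvᵢ`; §4.2: `R̊̄_q = ∂ₜχᵢ ℛ(vᵢ - vᵢ₊₁) - χᵢ(1-χᵢ)(vᵢ - vᵢ₊₁) ⊗̊ (vᵢ - vᵢ₊₁)`,
`p̄_q = ∑ χᵢpᵢ - χᵢ(1-χᵢ)|vᵢ - vᵢ₊₁|²` on `Iᵢ`, with Prop. 4.1 (`ℛ` symmetric, `div ℛf = f` for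
mean-free `f`): "`R̊̄_q` is a smooth symmetric and traceless 2-tensor", the triple solves
Euler–Reynolds, `supp R̊̄_q ⊂ T³ × ⋃ Iᵢ`; §4.3 Prop. 4.2 = (2.18)–(2.19); §4.4 Prop. 4.3 =
(2.20)–(2.21), Prop. 4.4 = (2.22); implicit constants depending on `M, α, N` and on those of
§3). For `0 < β < 1/3`, `1 < b < (1-β)/(2β)` there is `α₀(β,b) > 0` such that for `0 < α < α₀`,
every `N̄`, every family `(C_N)` and every `C₃` there are `C` and `a₀ > 1` such that for `a ≥ a₀`,
`T > 0`, `q`, every Euler–Reynolds triple `(v_ℓ, p_ℓ, R̊_ℓ)` on `[0,T] × T³` with (2.13)–(2.14)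
for all `N`, and every family `(vᵢ, pᵢ)_{i ∈ ℕ}` such that, for each `i` with `tᵢ = iτ_q ≤ T`,
`(vᵢ, pᵢ)` is a smooth exact Euler solution on `Sᵢ = [tᵢ - τ_q, tᵢ + τ_q] ∩ [0,T]` with
`vᵢ(tᵢ) = v_ℓ(tᵢ)` and the bounds of Cor. 3.2/Prop. 3.3 with constant `C₃` for `N ≤ N̄ + 2`, and,
for each `i` with `tᵢ₊₁ ≤ T`, the pair `(vᵢ, vᵢ₊₁)` obeys the bounds of Prop. 3.4 with constant
`C₃` for `N ≤ N̄ + 2`, there is an Euler–Reynolds triple `(v̄_q, p̄_q, R̊̄_q)` on `[0,T] × T³` with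
(2.17) `supp R̊̄_q ⊂ ⋃ₙ Iₙ × T³` and (2.18)–(2.22) with constant `C` for `N ≤ N̄`, verbatim as in
`BDSV.gluingStage`. Only anchors `tᵢ ≤ T` are used (the last two cut-offs merged, see the
module docstring). [cite: BuckmasterEtAl2018, §4 (Props. 4.1, 4.2, 4.3, 4.4)] -/
def gluedTripleEstimates : Prop :=
  ∀ β : ℝ, 0 < β → β < 1 / 3 → ∀ b : ℝ, 1 < b → b < (1 - β) / (2 * β) →
    ∃ α₀ : ℝ, 0 < α₀ ∧ ∀ α : ℝ, 0 < α → α < α₀ → ∀ (Nbar : ℕ) (Cin : ℕ → ℝ) (C₃ : ℝ),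
      ∃ (C a₀ : ℝ), 1 < a₀ ∧ ∀ a : ℝ, a₀ ≤ a → ∀ T : ℝ, 0 < T →
        ∀ (q : ℕ) (vℓ : ℝ → 𝕋³ → ℝ³) (pℓ : ℝ → 𝕋³ → ℝ) (Rℓ : ℝ → 𝕋³ → Fin 3 → ℝ³),
          Torus.IsEulerReynoldsOn (Icc 0 T) vℓ pℓ Rℓ →
          (∀ N : ℕ, HolderSupLE T vℓ (N + 1) 0
            (Cin N * (Real.sqrt (amp β a b q) * freq a b q * mollScale β α a b q ^ (-(N : ℝ))))) →
          (∀ N : ℕ, HolderSupLE T Rℓ N (Real.toNNReal α)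
            (Cin N * (amp β a b (q + 1) * mollScale β α a b q ^ (-(N : ℝ) + α)))) →
          ∀ (v : ℕ → ℝ → 𝕋³ → ℝ³) (p : ℕ → ℝ → 𝕋³ → ℝ),
            (∀ i : ℕ, (i : ℝ) * glueScale β α a b q ≤ T →
              IsExactEulerOn (glueInterval T (glueScale β α a b q) i) (v i) (p i) ∧
              v i ((i : ℝ) * glueScale β α a b q) = vℓ ((i : ℝ) * glueScale β α a b q) ∧
              StabilityBounds β α a b T C₃ q (Nbar + 2) i vℓ pℓ (v i) (p i)) →
            (∀ i : ℕ, ((i + 1 : ℕ) : ℝ) * glueScale β α a b q ≤ T →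
              PotentialBounds β α a b T C₃ q (Nbar + 2) i vℓ (v i) (v (i + 1))) →
              ∃ (vbar : ℝ → 𝕋³ → ℝ³) (pbar : ℝ → 𝕋³ → ℝ) (Rbar : ℝ → 𝕋³ → Fin 3 → ℝ³),
                Torus.IsEulerReynoldsOn (Icc 0 T) vbar pbar Rbar ∧
                SupportedOnGlueIntervals T (glueScale β α a b q) Rbar ∧
                SupLE T (fun t x => vbar t x - vℓ t x)
                  (C * (Real.sqrt (amp β a b (q + 1)) * mollScale β α a b q ^ α)) ∧
                (∀ N : ℕ, N ≤ Nbar → HolderSupLE T vbar (N + 1) 0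
                  (C * (Real.sqrt (amp β a b q) * freq a b q * mollScale β α a b q ^ (-(N : ℝ))))) ∧
                (∀ N : ℕ, N ≤ Nbar → HolderSupLE T Rbar N (Real.toNNReal α)
                  (C * (amp β a b (q + 1) * mollScale β α a b q ^ (-(N : ℝ) + α)))) ∧
                (∀ N : ℕ, N ≤ Nbar → HolderSupLE T (advectiveDeriv T vbar Rbar) N (Real.toNNReal α)
                  (C * (amp β a b (q + 1) * Real.sqrt (amp β a b q) * freq a b q *
                    mollScale β α a b q ^ (-(N : ℝ) - α)))) ∧
                ∀ t ∈ Icc 0 T, |(∫ x, ‖vbar t x‖ ^ 2) - ∫ x, ‖vℓ t x‖ ^ 2| ≤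
                  C * (amp β a b (q + 1) * mollScale β α a b q ^ α)

end Facts

end BDSV

end Literature.Analysis.FluidPDE
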